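/-
Copyright: the b2b-balaban T⁴-continuum CRUX team, row NE7b owner lineage `t4-ne7b-p1` (gen 116). Project licence.
-/
import Summits.QuantumFields.BalabanUV.T4Continuum.Spine.NE7b.SupBackgroundTower

/-!
# THE INTERACTING SUP TOWER AT THE DERIVATIVE LEVEL: on the open chart balls the step branches `τ_j = Q′_j∘σ_{j+1}` of the owner's
# `…SupBackgroundTower` are differentiable sections of the one-step average with `‖Dτ_j‖ ≤ (N⁻¹ − c)⁻¹`, the responses obey THE CHAIN
# RULE `Dσ_{j+1}(w) = Dσ_j(τ_j w) ∘ Dτ_j(w)`, and the linearised composite sections `𝒮_j := Dσ_j(0)` satisfy SET's recursion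
# `𝒮_{j+1} = 𝒮_j ∘ Dτ_j(0)` with the LEVEL-FREE letter `‖𝒮_j‖ ≤ (N⁻¹ − c)⁻¹` — SECS's displayed product `∏_{i<j} N^w_i` replaced by one
# constant in the `ℓ^∞(ℤ^d)` instance (row NE7b, node U5c; the owner's tower file BY NAME + the chain rule; [folklore])

Cell `pub-balaban`, sub-cell `t4`, spine estimate NE7b (`T4WeightBudget.RelWeightBound`; the cell's OWN estimate — NOT PRINTED in
[Bałaban 1983–89], NOT PROVED).  Crux-route work under `Spine/NE7b/` by the row OWNER (`t4-ne7b-p1` gen 116) under FREEZE (0)'s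
crux-prover clause (FILING-CLAIM C-ne7bp1-g116-8); NOTHING of Bałaban's is named, valued or asserted; no `T4Continuum/Support` leaf
typed; no `def`, no notation; zero `sorry`.  Imports (BY NAME): the owner's `…SupBackgroundTower` (`exists_background_tower`,
`chartFactor_pos`; through it (51) `abs_blockAvg_le`, (58)-style `abs_apply_le_norm`).

WHY (located).  Leaf-06's SET ∕ SECS read the tower's charts on the linearised composite sections `𝒮_k = Dσ_0(0)∘⋯∘Dσ_{k−1}(0)`
(`= DΦ_k(0)`, STL) and book, for every second currency, the PRODUCT letter `p_0(𝒮_k v) ≤ (∏_{j<k} N^w_j)·p_k(v)` («no control»,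
PRICING-NE7b F784 ∕ F793).  In the owner's closed-form tower the composite transport `Φ_j` IS the one-shot background `σ_j`, so
`𝒮_j = Dσ_j(0)` carries (60)'s ONE-STEP letter `‖Dσ_j(0)‖ ≤ (N⁻¹ − c)⁻¹` at every level — the product is controlled by construction —
and SET's recursion (R) `𝒮_{j+1} = 𝒮_j∘Dσ^{SET}_j(0)` is the chain rule along `σ_{j+1} = σ_j∘τ_j` at the origin.  This file types the
derivative-level dictionary: §1 the chain rule through a factorisation `σ = σ′∘τ` valid on a neighbourhood (Mathlib's `HasFDerivAt.comp`
+ `HasFDerivAt.congr_of_eventuallyEq` + uniqueness of derivatives), §2 the tower's instance on the OPEN balls (the step branch lands in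
the open ball one level down because `‖σ_{j+1} w‖ ≤ (N⁻¹ − c)⁻¹‖w‖ < r_{j+1} = (N⁻¹ − c)·r_j`).

WHAT IS PROVED ([folklore]; `ℓ^∞ := lp (fun _ : X d => ℝ) ∞`):
* §1 `fderiv_of_factorisation` (any normed spaces: `σ =ᶠ[𝓝 w] σ′∘τ`, `τ` differentiable at `w`, `σ′` at `τ w` ⟹
  `fderiv σ w = fderiv σ′ (τ w) ∘ fderiv τ w`), `norm_blockAvg_apply_le` (`‖Q′f‖ ≤ ‖f‖` from the displayed action).
* §2 **`exists_background_tower_deriv`** — the owner's `exists_background_tower` hypotheses VERBATIM ⟹ its operators and backgrounds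
  with (re-exported) the actions, `σ_j 0 = 0`, the closed-ball letters, Lipschitz, the derivative clause, `Q′_1∘Q′_j = Q′_{j+1}`, the
  semigroup clause, AND for `j < J`, on the OPEN ball `‖w‖ < (N⁻¹ − c)·r_{j+1}`: `Q′_j(σ_{j+1} w)` lies in level `j`'s OPEN chart ball;
  the step branch `τ_j = Q′_j∘σ_{j+1}` is differentiable at `w` with `fderiv τ_j w = Q′_j ∘ fderiv σ_{j+1} w`, `‖fderiv τ_j w‖ ≤ (N⁻¹ − c)⁻¹`,
  `Q′_1 ∘ fderiv τ_j w = 1`; **THE CHAIN RULE `fderiv σ_{j+1} w = fderiv σ_j (τ_j w) ∘ fderiv τ_j w`**; and at the origin SET's recursion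
  `Dσ_{j+1}(0) = Dσ_j(0) ∘ Dτ_j(0)` with `‖Dσ_j(0)‖ ≤ (N⁻¹ − c)⁻¹` AT EVERY LEVEL (`r > 0`).
* §3 toy.

HONEST (what this is NOT).  SET's equation maps and admissible-section charts are not instantiated (the dictionary is at the level of
branches and their derivatives); second currencies (weighted letters of `Dσ_j(0)`: (63) at side `n_j + 1`, uniform by the same token —
not restated); nothing of the covariant `H_k`, (A3) ∕ (A1c) (NC-NE7b-α UNRULED).  BY-NAME EFFECT ON THE WALL: NONE.  NE7b NOT PRINTED ∕
NOT PROVED; spine PROVED 0∕9; rung (B)+1 on a FINITE torus — NOT infinite volume, NOT the mass gap, NOT Clay.  HONEST DEPENDENCY: continuum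
YM on T⁴ ⇐ BetaPertH ∧ nine spine estimates (0∕9 proved); BetaPertH ⇐ (D1) ∧ (D4) ∧ CAP+tail; G-an2-4 gates asym, D1 and NE2∕3∕4.
-/

set_option autoImplicit false

noncomputable section

namespace Summit.QuantumFields.BalabanUV.T4Continuum.NE7b.SupBackgroundTowerLetters

open scoped ENNReal NNReal Topology
open Metric Set Filter
open Literature.MathematicalPhysics.QuantumFieldTheory.Balaban1983to89
open B4Sect5Proof (latticeConst latticeConst_nonneg)
open B6QGQLower276 (X e blk B mem_B sum_B_const AX)
open B6QGQDecay237 (deltaU deltaU_pos)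
open B5Hk103ScalarZd (nbhd deltaH deltaH_pos)
open Summit.QuantumFields.BalabanUV.Beta.D1BFx.BlockColumnSupNorm (cHs cHs_nonneg)
open Summit.QuantumFields.BalabanUV.Beta.D1BFx.PointColumnSplit (cKL cG0 cSplit)
open Summit.QuantumFields.BalabanUV.Beta.D1BFx.PointColumnDecay (cFar)
open OneShotChartSupOperator (abs_apply_le_norm)
open FibreInverseSupNorm (abs_blockAvg_le)
open SupBackgroundTower (exists_background_tower chartFactor_pos)

variable {d : ℕ}

/-! ## §1. The chain rule through a local factorisation; the block average does not increase the norm -/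

section Chain

variable {E₁ E₂ E₃ : Type*} [NormedAddCommGroup E₁] [NormedSpace ℝ E₁] [NormedAddCommGroup E₂] [NormedSpace ℝ E₂]
  [NormedAddCommGroup E₃] [NormedSpace ℝ E₃]

/-- **THE CHAIN RULE THROUGH A FACTORISATION VALID NEAR `w`**: if `σ = σ′ ∘ τ` on a neighbourhood of `w`, `τ` is differentiable at `w`
and `σ′` at `τ w`, then `σ` is differentiable at `w` and `fderiv σ w = fderiv σ′ (τ w) ∘ fderiv τ w`. [folklore] -/
theorem fderiv_of_factorisation {σ : E₁ → E₃} {σ' : E₂ → E₃} {τ : E₁ → E₂} {w : E₁} (hfac : σ =ᶠ[𝓝 w] σ' ∘ τ)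
    (hτ : DifferentiableAt ℝ τ w) (hσ' : DifferentiableAt ℝ σ' (τ w)) :
    DifferentiableAt ℝ σ w ∧ fderiv ℝ σ w = (fderiv ℝ σ' (τ w)).comp (fderiv ℝ τ w) := by
  have h : HasFDerivAt σ ((fderiv ℝ σ' (τ w)).comp (fderiv ℝ τ w)) w :=
    (hσ'.hasFDerivAt.comp w hτ.hasFDerivAt).congr_of_eventuallyEq hfac
  exact ⟨h.differentiableAt, h.fderiv⟩

end Chain

/-- `‖Q′f‖ ≤ ‖f‖` from the displayed action of the block average. [folklore] -/
theorem norm_blockAvg_apply_le {n : ℕ} {Dop : lp (fun _ : X d => ℝ) ∞ →L[ℝ] lp (fun _ : X d => ℝ) ∞}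
    (hD : ∀ (f : lp (fun _ : X d => ℝ) ∞) (y : X d), Dop f y = (((n : ℝ) + 1) ^ d)⁻¹ * ∑ p ∈ B n y, f p)
    (f : lp (fun _ : X d => ℝ) ∞) : ‖Dop f‖ ≤ ‖f‖ :=
  lp.norm_le_of_forall_le (norm_nonneg f) fun y => by
    rw [Real.norm_eq_abs, hD]; exact abs_blockAvg_le n (abs_apply_le_norm f) y

/-! ## §2. The tower at the derivative level -/

/-- **THE INTERACTING SUP TOWER AT THE DERIVATIVE LEVEL** (`d ≥ 3`; the owner's `exists_background_tower` hypotheses verbatim): the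
tower's operators and backgrounds with their letters, and for `j < J`, on the OPEN ball `‖w‖ < (N⁻¹ − c)·r_{j+1}`
(`r_j = r∕(N⁻¹ − c)^{J−j}`): the step branch `τ_j w = Q′_j(σ_{j+1} w)` lies in level `j`'s open chart ball, is differentiable with
`fderiv τ_j w = Q′_j ∘ fderiv σ_{j+1} w`, `‖fderiv τ_j w‖ ≤ (N⁻¹ − c)⁻¹`, `Q′_1 ∘ fderiv τ_j w = 1`, THE CHAIN RULE
`fderiv σ_{j+1} w = fderiv σ_j (τ_j w) ∘ fderiv τ_j w`; and, when `r > 0`, SET's recursion at the origin with the level-free letter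
`‖Dσ_j(0)‖ ≤ (N⁻¹ − c)⁻¹`. [folklore] -/
theorem exists_background_tower_deriv (hd : 3 ≤ d) (ℓ : ℕ) {a : ℝ} (ha : 0 < a)
    {u u' : ℝ → ℝ} (hu : ∀ t, HasDerivAt u (u' t) t) (hu0 : u 0 = 0) {lam c N : ℝ≥0} (hlam : ∀ t, |u' t| ≤ lam)
    {L : ℝ} (hL0 : 0 ≤ L) (hL : ∀ s t, |u' s - u' t| ≤ L * |s - t|)
    (hN : cHs d a * latticeConst d (deltaH d a)
        + ((cG0 d * cKL d (d - 2) + cSplit d a) * Real.exp (2 * deltaU d a)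
            + cFar d a * Real.exp (4 * deltaU d a) / deltaU d a ^ 2) * latticeConst d (deltaU d a / 4)
          * (1 + cHs d a * latticeConst d (deltaH d a)) ≤ (N : ℝ))
    (hc : 2 * lam ≤ c) (hcN : c < N⁻¹) (n : ℕ → ℕ) (hn0 : n 0 = 0) (hn : ∀ j, n (j + 1) + 1 = (n j + 1) * (ℓ + 1))
    (J : ℕ) {r : ℝ} (hr : 0 ≤ r) :
    ∃ (Dop Aop Pop : ℕ → (lp (fun _ : X d => ℝ) ∞ →L[ℝ] lp (fun _ : X d => ℝ) ∞))
      (σ : ℕ → (lp (fun _ : X d => ℝ) ∞ → lp (fun _ : X d => ℝ) ∞)),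
      (∀ (j : ℕ) (f : lp (fun _ : X d => ℝ) ∞) (y : X d), Dop j f y = (((n j : ℝ) + 1) ^ d)⁻¹ * ∑ p ∈ B (n j) y, f p) ∧
      (∀ (j : ℕ) (f : lp (fun _ : X d => ℝ) ∞) (p : X d), Aop j f p = ∑ r ∈ nbhd (n j) p, AX (n j) a p r * f r) ∧
      (∀ (j : ℕ) (f : lp (fun _ : X d => ℝ) ∞) (p : X d),
        Pop j f p = f p - (((n j : ℝ) + 1) ^ d)⁻¹ * ∑ p' ∈ B (n j) (blk (n j) p), f p') ∧
      (∀ j, σ j 0 = 0) ∧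
      (∀ j, ∀ w ∈ closedBall (0 : lp (fun _ : X d => ℝ) ∞) (((N : ℝ)⁻¹ - c) * (r / ((N : ℝ)⁻¹ - c) ^ (J - j))),
        σ j w ∈ closedBall 0 (r / ((N : ℝ)⁻¹ - c) ^ (J - j)) ∧ Dop j (σ j w) = w ∧
          ∀ p : X d, Aop j (σ j w) p + ((((ℓ : ℝ) + 1) ^ 2)⁻¹) ^ (J - j) * u (σ j w p)
            = (((n j : ℝ) + 1) ^ d)⁻¹ * ∑ p' ∈ B (n j) (blk (n j) p),
                (Aop j (σ j w) p' + ((((ℓ : ℝ) + 1) ^ 2)⁻¹) ^ (J - j) * u (σ j w p'))) ∧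
      (∀ j, LipschitzOnWith (N⁻¹ - c)⁻¹ (σ j)
        (closedBall (0 : lp (fun _ : X d => ℝ) ∞) (((N : ℝ)⁻¹ - c) * (r / ((N : ℝ)⁻¹ - c) ^ (J - j))))) ∧
      (∀ j, ∀ w ∈ ball (0 : lp (fun _ : X d => ℝ) ∞) (((N : ℝ)⁻¹ - c) * (r / ((N : ℝ)⁻¹ - c) ^ (J - j))),
        DifferentiableAt ℝ (σ j) w ∧ ‖fderiv ℝ (σ j) w‖ ≤ ((N : ℝ)⁻¹ - c)⁻¹ ∧
          (Dop j).comp (fderiv ℝ (σ j) w) = ContinuousLinearMap.id ℝ (lp (fun _ : X d => ℝ) ∞)) ∧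
      (∀ j, (Dop 1).comp (Dop j) = Dop (j + 1)) ∧
      (∀ j, j < J → ∀ w ∈ closedBall (0 : lp (fun _ : X d => ℝ) ∞) (((N : ℝ)⁻¹ - c) * (r / ((N : ℝ)⁻¹ - c) ^ (J - (j + 1)))),
        Dop j (σ (j + 1) w) ∈ closedBall (0 : lp (fun _ : X d => ℝ) ∞) (((N : ℝ)⁻¹ - c) * (r / ((N : ℝ)⁻¹ - c) ^ (J - j))) ∧
          Dop 1 (Dop j (σ (j + 1) w)) = w ∧ σ j (Dop j (σ (j + 1) w)) = σ (j + 1) w) ∧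
      -- THE DERIVATIVE LEVEL
      (∀ j, j < J → ∀ w ∈ ball (0 : lp (fun _ : X d => ℝ) ∞) (((N : ℝ)⁻¹ - c) * (r / ((N : ℝ)⁻¹ - c) ^ (J - (j + 1)))),
        Dop j (σ (j + 1) w) ∈ ball (0 : lp (fun _ : X d => ℝ) ∞) (((N : ℝ)⁻¹ - c) * (r / ((N : ℝ)⁻¹ - c) ^ (J - j))) ∧
        DifferentiableAt ℝ (fun w => Dop j (σ (j + 1) w)) w ∧
        fderiv ℝ (fun w => Dop j (σ (j + 1) w)) w = (Dop j).comp (fderiv ℝ (σ (j + 1)) w) ∧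
        ‖fderiv ℝ (fun w => Dop j (σ (j + 1) w)) w‖ ≤ ((N : ℝ)⁻¹ - c)⁻¹ ∧
        (Dop 1).comp (fderiv ℝ (fun w => Dop j (σ (j + 1) w)) w) = ContinuousLinearMap.id ℝ (lp (fun _ : X d => ℝ) ∞) ∧
        fderiv ℝ (σ (j + 1)) w
          = (fderiv ℝ (σ j) (Dop j (σ (j + 1) w))).comp (fderiv ℝ (fun w => Dop j (σ (j + 1) w)) w)) ∧
      (0 < r → ∀ j, j < J →
        fderiv ℝ (σ (j + 1)) 0 = (fderiv ℝ (σ j) 0).comp (fderiv ℝ (fun w => Dop j (σ (j + 1) w)) 0) ∧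
          ‖fderiv ℝ (σ j) 0‖ ≤ ((N : ℝ)⁻¹ - c)⁻¹ ∧ ‖fderiv ℝ (σ (j + 1)) 0‖ ≤ ((N : ℝ)⁻¹ - c)⁻¹) := by
  obtain ⟨Dop, Aop, Pop, σ, hD, hA, hP, hσ0, hσ, hlip, huniq, hderiv, hcomp, hstep, hlipstep⟩ :=
    exists_background_tower hd ℓ ha hu hu0 hlam hL0 hL hN hc hcN n hn0 hn J hr
  have hK := chartFactor_pos hcN
  have hK0 : (0 : ℝ) ≤ ((N : ℝ)⁻¹ - c)⁻¹ := inv_nonneg.2 hK.le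
  have hDn : ∀ (j : ℕ) (f : lp (fun _ : X d => ℝ) ∞), ‖Dop j f‖ ≤ ‖f‖ := fun j f => norm_blockAvg_apply_le (hD j) f
  have hrad : ∀ j, j < J → r / ((N : ℝ)⁻¹ - c) ^ (J - (j + 1)) = ((N : ℝ)⁻¹ - c) * (r / ((N : ℝ)⁻¹ - c) ^ (J - j)) := by
    intro j hj
    have e : J - j = (J - (j + 1)) + 1 := by omega
    rw [e, pow_succ, ← div_div, mul_div_cancel₀ _ hK.ne']
  -- `‖σ_{j+1} w‖ ≤ K₁‖w‖` on the closed ball (Lipschitz from `σ 0 = 0`)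
  have hσn : ∀ j, ∀ w ∈ closedBall (0 : lp (fun _ : X d => ℝ) ∞) (((N : ℝ)⁻¹ - c) * (r / ((N : ℝ)⁻¹ - c) ^ (J - j))),
      ‖σ j w‖ ≤ ((N : ℝ)⁻¹ - c)⁻¹ * ‖w‖ := by
    intro j w hw
    have h0 : (0 : lp (fun _ : X d => ℝ) ∞) ∈ closedBall (0 : lp (fun _ : X d => ℝ) ∞)
        (((N : ℝ)⁻¹ - c) * (r / ((N : ℝ)⁻¹ - c) ^ (J - j))) :=
      mem_closedBall_self (by rw [mem_closedBall, dist_zero_right] at hw; exact (norm_nonneg w).trans hw)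
    have h := (hlip j).dist_le_mul w hw 0 h0
    rwa [hσ0, dist_zero_right, dist_zero_right, NNReal.coe_inv, NNReal.coe_sub hcN.le, NNReal.coe_inv] at h
  -- the derivative level
  have hder : ∀ j, j < J → ∀ w ∈ ball (0 : lp (fun _ : X d => ℝ) ∞) (((N : ℝ)⁻¹ - c) * (r / ((N : ℝ)⁻¹ - c) ^ (J - (j + 1)))),
      Dop j (σ (j + 1) w) ∈ ball (0 : lp (fun _ : X d => ℝ) ∞) (((N : ℝ)⁻¹ - c) * (r / ((N : ℝ)⁻¹ - c) ^ (J - j))) ∧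
      DifferentiableAt ℝ (fun w => Dop j (σ (j + 1) w)) w ∧
      fderiv ℝ (fun w => Dop j (σ (j + 1) w)) w = (Dop j).comp (fderiv ℝ (σ (j + 1)) w) ∧
      ‖fderiv ℝ (fun w => Dop j (σ (j + 1) w)) w‖ ≤ ((N : ℝ)⁻¹ - c)⁻¹ ∧
      (Dop 1).comp (fderiv ℝ (fun w => Dop j (σ (j + 1) w)) w) = ContinuousLinearMap.id ℝ (lp (fun _ : X d => ℝ) ∞) ∧
      fderiv ℝ (σ (j + 1)) w
        = (fderiv ℝ (σ j) (Dop j (σ (j + 1) w))).comp (fderiv ℝ (fun w => Dop j (σ (j + 1) w)) w) := by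
    intro j hj w hw
    have hw' : w ∈ closedBall (0 : lp (fun _ : X d => ℝ) ∞) (((N : ℝ)⁻¹ - c) * (r / ((N : ℝ)⁻¹ - c) ^ (J - (j + 1)))) :=
      ball_subset_closedBall hw
    rw [mem_ball, dist_zero_right] at hw
    obtain ⟨hdiff, hDσn, hDD⟩ := hderiv (j + 1) w (by rwa [mem_ball, dist_zero_right])
    -- the step branch lands in the OPEN ball one level down
    have hτball : Dop j (σ (j + 1) w) ∈ ball (0 : lp (fun _ : X d => ℝ) ∞) (((N : ℝ)⁻¹ - c) * (r / ((N : ℝ)⁻¹ - c) ^ (J - j))) := by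
      rw [mem_ball, dist_zero_right, ← hrad j hj]
      have h1 := (hDn j _).trans (hσn (j + 1) w hw')
      have h2 : ((N : ℝ)⁻¹ - c)⁻¹ * ‖w‖ < ((N : ℝ)⁻¹ - c)⁻¹ * (((N : ℝ)⁻¹ - c) * (r / ((N : ℝ)⁻¹ - c) ^ (J - (j + 1)))) :=
        mul_lt_mul_of_pos_left hw (inv_pos.2 hK)
      rw [← mul_assoc, inv_mul_cancel₀ hK.ne', one_mul] at h2
      exact lt_of_le_of_lt h1 h2
    -- `τ_j = Q′_j ∘ σ_{j+1}` is differentiable with derivative `Q′_j ∘ Dσ_{j+1}`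
    have hτ : HasFDerivAt (fun w => Dop j (σ (j + 1) w)) ((Dop j).comp (fderiv ℝ (σ (j + 1)) w)) w :=
      (Dop j).hasFDerivAt.comp w hdiff.hasFDerivAt
    have hτd : DifferentiableAt ℝ (fun w => Dop j (σ (j + 1) w)) w := hτ.differentiableAt
    have hτf : fderiv ℝ (fun w => Dop j (σ (j + 1) w)) w = (Dop j).comp (fderiv ℝ (σ (j + 1)) w) := hτ.fderiv
    -- the factorisation `σ_{j+1} = σ_j ∘ τ_j` holds on a neighbourhood of `w`
    have hfac : σ (j + 1) =ᶠ[𝓝 w] (σ j) ∘ (fun w => Dop j (σ (j + 1) w)) := by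
      have hopen : ball (0 : lp (fun _ : X d => ℝ) ∞) (((N : ℝ)⁻¹ - c) * (r / ((N : ℝ)⁻¹ - c) ^ (J - (j + 1)))) ∈ 𝓝 w :=
        isOpen_ball.mem_nhds (by rwa [mem_ball, dist_zero_right])
      filter_upwards [hopen] with w' hw'
      exact ((hstep j hj w' (ball_subset_closedBall hw')).2.2).symm
    obtain ⟨hdiffj, -, -⟩ := hderiv j _ hτball
    have hchain := (fderiv_of_factorisation hfac hτd hdiffj).2
    refine ⟨hτball, hτd, hτf, ?_, ?_, hchain⟩
    · rw [hτf]
      refine (ContinuousLinearMap.opNorm_comp_le _ _).trans ?_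
      calc ‖Dop j‖ * ‖fderiv ℝ (σ (j + 1)) w‖ ≤ 1 * ((N : ℝ)⁻¹ - c)⁻¹ :=
            mul_le_mul (ContinuousLinearMap.opNorm_le_bound _ zero_le_one fun f => by rw [one_mul]; exact hDn j f)
              hDσn (norm_nonneg _) zero_le_one
        _ = _ := one_mul _
    · rw [hτf, ← ContinuousLinearMap.comp_assoc, hcomp, hDD]
  refine ⟨Dop, Aop, Pop, σ, hD, hA, hP, hσ0, hσ, hlip, hderiv, hcomp, hstep, hder, fun hr0 j hj => ?_⟩
  have h0j1 : (0 : lp (fun _ : X d => ℝ) ∞) ∈ ball (0 : lp (fun _ : X d => ℝ) ∞)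
      (((N : ℝ)⁻¹ - c) * (r / ((N : ℝ)⁻¹ - c) ^ (J - (j + 1)))) :=
    mem_ball_self (mul_pos hK (div_pos hr0 (pow_pos hK _)))
  have h0j : (0 : lp (fun _ : X d => ℝ) ∞) ∈ ball (0 : lp (fun _ : X d => ℝ) ∞)
      (((N : ℝ)⁻¹ - c) * (r / ((N : ℝ)⁻¹ - c) ^ (J - j))) :=
    mem_ball_self (mul_pos hK (div_pos hr0 (pow_pos hK _)))
  obtain ⟨-, -, -, -, -, hchain⟩ := hder j hj 0 h0j1
  have hτ0 : Dop j (σ (j + 1) 0) = 0 := by rw [hσ0, map_zero]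
  rw [hτ0] at hchain
  exact ⟨hchain, (hderiv j 0 h0j).2.1, (hderiv (j + 1) 0 h0j1).2.1⟩

/-! ## §3. Toy -/

/-- Toy: §1 on the identity factorisation `σ = σ ∘ id` at any point of a normed space. -/
example {E : Type*} [NormedAddCommGroup E] [NormedSpace ℝ E] (σ : E → E) (w : E) (hσ : DifferentiableAt ℝ σ w) :
    fderiv ℝ σ w = (fderiv ℝ σ (id w)).comp (fderiv ℝ (id : E → E) w) :=
  (fderiv_of_factorisation (σ := σ) (σ' := σ) (τ := id) (Filter.Eventually.of_forall fun _ => rfl)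
    differentiableAt_id hσ).2

end Summit.QuantumFields.BalabanUV.T4Continuum.NE7b.SupBackgroundTowerLetters

end
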